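import Summits.RiemannHypothesis.RiemannHypothesis.Theorems.TiltedLandingLaw421R3PairExactLocation

/-! # TiltedLandingLaw421 — R3 PAIR-EXACT f-SIDE (C1 IMAGE v2; director (CA875)): cofactor witness, location O2/O2a, pair terms O1a, light witness O1b, located child L1 ∘ O2
IMAGE = f-side SKETCH OF RECORD v3 6ae8a9416a81f889 ((CA858)(3)) + addendum v4 c426cbe5d229964f, re-based BY IMPORT on the landed L1 `…R3PairExactLocation` (89; C2 rh-idea-2; its import
is #1230 `…R3K2NoZFloor`) + NEW §7 = the located child BY NAME.  v2 = v1 d67cd0eb723a2b58 MINUS two re-proved tree lemmas (`dedup.landed`, the lint that bounced 89 v2): `dslope F v = G`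
is `RhW08.NewtonDoor.dslope_eq_of_factor` BY NAME, the inverse-factor derivative is a local `have`; the 13 remaining statements and proofs = v4 verbatim.  SUPPORT (K only).
ARCHITECTURE (c) ((CA839)(2); spec `GeometricBudgetPairExact`, C1 ADD-6): a located child `u` of the pair `(w, p)`, `F = (·−w)(·−w̄)(·−p)(·−p̄)·g`, is constrained IMPLICITLY on the count
disc `‖u − w‖ ≤ 3/‖K_w‖` by `‖(u−w)⁻¹ + (u−w̄)⁻¹ + (u−p)⁻¹ + (u−p̄)⁻¹ + (g′/g)(w)‖ ≤ M·‖u−w‖/Im w²`, `M` a COFACTOR-ONLY mass (T2 `M ≤ A·G`: socket `RhW08.MassSign.MassSignCouplingQ`).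
§1 `CofactorWitness` (twin of `LightWitness`, #1190) · §2 O2 `location_of_childEq` (child equation + witness ⇒ implicit clause; mean value on the disc) · §3 O2a `childEq_of_deriv_eq_zero`
· §4 O1a `pairTerms_mass_le`/`fullMass_le` (f-free; floor 30, `Im v ≤ 2‖v−p‖`, `Im v < Im p` ⇒ pair terms ≤ 7 = 7/25 + 127/20 + 7/25, `M_full ≤ 7 + M`) · §5 O1b `lightWitness_of_cofactorWitness`
(tree `LightWitness (dslope F v) v (7 + M)`; K-2's count/door #1190 ff. runs unchanged) · §6 parametric toucher-side twins (`lam ≤ Im w·‖K_w‖`, `d0·Im w ≤ ‖w−o‖`) · §7 ★ `located_child`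
= C2 g54 ADD-1's compose (bus l.3818, 30f730ff73901166) BY NAME: L1 `pairExactLocationQ_18` ∘ O2.  NOT HERE: O1 proper, O3 coherence (`RhW08.PairCoherence.coherence_of_hull`), z-side door
arithmetic, cell table (C2), T2 witnesses.  Nothing here bears on the truth of RH; RH is not proved; ⟨33346⟩/⟨33347⟩ OPEN; socket 3′ `HeavyMassWindowQ (1/2) 1` OPEN; keyed ≠ landed ≠ proved. -/
namespace RhW08.PairExactFSide

open Complex Metric Set Filter Topology
open scoped ComplexConjugate

/-! ## §1 The cofactor witness -/

/-- §1 **COFACTOR WITNESS** `M` at `w` for the pair cofactor `g`, on the count disc of the full field `K`: `0 ≤ M` and for every `u` with `‖u − w‖ ≤ 3/‖K‖`,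
`g u ≠ 0` and `Im w²·‖(g′/g)′(u)‖ ≤ M` (cofactor twin of `RhW08.PerturbativeRung.LightWitness`, whose `h = dslope f⁽ʲ⁾ w` still contains `w̄, p, p̄`). -/
def CofactorWitness (g : ℂ → ℂ) (w K : ℂ) (M : ℝ) : Prop :=
  0 ≤ M ∧ ∀ u : ℂ, ‖u - w‖ ≤ 3 / ‖K‖ → g u ≠ 0 ∧ w.im ^ 2 * ‖deriv (fun t => deriv g t / g t) u‖ ≤ M

/-- §1 (K) a cofactor witness is monotone in the mass. -/
theorem cofactorWitness_mono {g : ℂ → ℂ} {w K : ℂ} {M M' : ℝ} (hM : M ≤ M') (h : CofactorWitness g w K M) : CofactorWitness g w K M' :=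
  ⟨h.1.trans hM, fun u hu => ⟨(h.2 u hu).1, (h.2 u hu).2.trans hM⟩⟩

/-! ## §2 (K) O2: the implicit location clause from the exact child equation -/

/-- ★ §2 (K, PROVED) **PAIR-EXACT LOCATION (O2).**  `g` entire with a cofactor witness `M` at `w` (`0 < Im w`) on the disc `‖u − w‖ ≤ 3/‖K‖`; if `u` in that
disc satisfies the exact child equation `(u−w)⁻¹ + (u−w̄)⁻¹ + (u−p)⁻¹ + (u−p̄)⁻¹ + (g′/g)(u) = 0`, then
`‖(u−w)⁻¹ + (u−w̄)⁻¹ + (u−p)⁻¹ + (u−p̄)⁻¹ + (g′/g)(w)‖ ≤ M·‖u − w‖/Im w²` — the located-child binder of `GeometricBudgetPairExact`, pair part EXACT. -/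
theorem location_of_childEq {g : ℂ → ℂ} (hg : Differentiable ℂ g) {w p K u : ℂ} {M : ℝ} (hw : 0 < w.im)
    (hW : CofactorWitness g w K M) (hu : ‖u - w‖ ≤ 3 / ‖K‖)
    (hchild : (u - w)⁻¹ + (u - conj w)⁻¹ + (u - p)⁻¹ + (u - conj p)⁻¹ + deriv g u / g u = 0) :
    ‖(u - w)⁻¹ + (u - conj w)⁻¹ + (u - p)⁻¹ + (u - conj p)⁻¹ + deriv g w / g w‖ ≤ M * ‖u - w‖ / w.im ^ 2 := by
  have e : (u - w)⁻¹ + (u - conj w)⁻¹ + (u - p)⁻¹ + (u - conj p)⁻¹ + deriv g w / g w =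
      -((deriv g u / g u) - (deriv g w / g w)) := by
    linear_combination hchild
  rw [e, norm_neg]
  have hdg : Differentiable ℂ (deriv g) := fun x => (hg.analyticAt x).deriv.differentiableAt
  have hdiff : ∀ x ∈ closedBall w (3 / ‖K‖), DifferentiableAt ℂ (fun t => deriv g t / g t) x := by
    intro x hx
    have hx' : ‖x - w‖ ≤ 3 / ‖K‖ := by rwa [mem_closedBall, dist_eq_norm] at hx
    exact ((hdg x).div (hg x) (hW.2 x hx').1)
  have hbound : ∀ x ∈ closedBall w (3 / ‖K‖), ‖deriv (fun t => deriv g t / g t) x‖ ≤ M / w.im ^ 2 := by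
    intro x hx
    have hx' : ‖x - w‖ ≤ 3 / ‖K‖ := by rwa [mem_closedBall, dist_eq_norm] at hx
    have h2 := (hW.2 x hx').2
    have hw2 : 0 < w.im ^ 2 := by positivity
    rw [le_div_iff₀ hw2]; linarith
  have hwmem : w ∈ closedBall w (3 / ‖K‖) := mem_closedBall_self (by positivity)
  have humem : u ∈ closedBall w (3 / ‖K‖) := by rwa [mem_closedBall, dist_eq_norm]
  have h := (convex_closedBall w (3 / ‖K‖)).norm_image_sub_le_of_norm_deriv_le hdiff hbound hwmem humem
  calc ‖deriv g u / g u - deriv g w / g w‖ ≤ M / w.im ^ 2 * ‖u - w‖ := h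
    _ = M * ‖u - w‖ / w.im ^ 2 := by ring

/-! ## §3 (K) O2a: the exact child equation from the product rule -/

/-- §3 (K) the derivative of the four-point pair product times the cofactor, at a point where nothing vanishes, divided through:
`F = (·−w)(·−w̄)(·−p)(·−p̄)·g`, `F′ u = 0`, all five factors non-zero at `u` ⇒ the exact child equation. -/
theorem childEq_of_deriv_eq_zero {g : ℂ → ℂ} (hg : Differentiable ℂ g) {w p u : ℂ}
    (h1 : u ≠ w) (h2 : u ≠ conj w) (h3 : u ≠ p) (h4 : u ≠ conj p) (hgu : g u ≠ 0)
    (hF : deriv (fun s => (s - w) * (s - conj w) * (s - p) * (s - conj p) * g s) u = 0) :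
    (u - w)⁻¹ + (u - conj w)⁻¹ + (u - p)⁻¹ + (u - conj p)⁻¹ + deriv g u / g u = 0 := by
  have hd : HasDerivAt (fun s => (s - w) * (s - conj w) * (s - p) * (s - conj p) * g s)
      ((((1 * (u - conj w) + (u - w) * 1) * (u - p) + (u - w) * (u - conj w) * 1) * (u - conj p)
        + (u - w) * (u - conj w) * (u - p) * 1) * g u + (u - w) * (u - conj w) * (u - p) * (u - conj p) * deriv g u) u := by
    have l1 : HasDerivAt (fun s : ℂ => s - w) 1 u := (hasDerivAt_id u).sub_const w
    have l2 : HasDerivAt (fun s : ℂ => s - conj w) 1 u := (hasDerivAt_id u).sub_const _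
    have l3 : HasDerivAt (fun s : ℂ => s - p) 1 u := (hasDerivAt_id u).sub_const p
    have l4 : HasDerivAt (fun s : ℂ => s - conj p) 1 u := (hasDerivAt_id u).sub_const _
    have l5 : HasDerivAt g (deriv g u) u := (hg u).hasDerivAt
    exact (((l1.mul l2).mul l3).mul l4).mul l5
  rw [hd.deriv] at hF
  have a1 : u - w ≠ 0 := sub_ne_zero.2 h1
  have a2 : u - conj w ≠ 0 := sub_ne_zero.2 h2
  have a3 : u - p ≠ 0 := sub_ne_zero.2 h3
  have a4 : u - conj p ≠ 0 := sub_ne_zero.2 h4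
  field_simp
  linear_combination hF

/-! ## §4 (K, f-free) O1a: the pair terms on the count disc -/

/-- §4 (K) one inverse-square term: `c·h ≤ ‖w‖`, `1 ≤ C·c²` ⇒ `h²·‖(w²)⁻¹‖ ≤ C`. -/
theorem sq_mul_norm_inv_sq_le {w : ℂ} {h c C : ℝ} (hh : 0 < h) (hc : 0 < c) (hw : c * h ≤ ‖w‖) (hC : 1 ≤ C * c ^ 2) :
    h ^ 2 * ‖(w ^ 2)⁻¹‖ ≤ C := by
  have hwpos : 0 < ‖w‖ := lt_of_lt_of_le (by positivity) hw
  rw [norm_inv, norm_pow, ← div_eq_mul_inv, div_le_iff₀ (by positivity)]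
  have h1 : (c * h) ^ 2 ≤ ‖w‖ ^ 2 := pow_le_pow_left₀ (by positivity) hw 2
  have hCpos : 0 < C := by
    by_contra hneg
    have : C * c ^ 2 ≤ 0 := mul_nonpos_of_nonpos_of_nonneg (not_lt.1 hneg) (sq_nonneg c)
    linarith
  have h2 : C * (c * h) ^ 2 ≤ C * ‖w‖ ^ 2 := mul_le_mul_of_nonneg_left h1 hCpos.le
  have h3 : 1 * h ^ 2 ≤ C * c ^ 2 * h ^ 2 := mul_le_mul_of_nonneg_right hC (pow_pos hh 2).le
  have e : C * (c * h) ^ 2 = C * c ^ 2 * h ^ 2 := by ring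
  linarith

/-- §4 (K, f-free) **COUNT-DISC GEOMETRY.**  `0 < Im v < Im p`, `Im v ≤ 2‖v − p‖`, floor `30 ≤ Im v·‖K + i/(2 Im v)‖`, `‖u − v‖ ≤ 3/‖K‖` ⇒
`Im v·‖K‖ ≥ 59/2`, radius `‖u − v‖ ≤ (6/59)·Im v`, and the distances `‖u − v̄‖, ‖u − p‖, ‖u − p̄‖ ≥ (112/59, 47/118, 112/59)·Im v`. -/
theorem countDisc_geometry {v p u K : ℂ} (hv : 0 < v.im) (hvp : v.im < p.im) (hsep : v.im ≤ 2 * ‖v - p‖)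
    (hfl : 30 ≤ v.im * ‖K + I / (2 * (v.im : ℂ))‖) (hu : ‖u - v‖ ≤ 3 / ‖K‖) :
    59 / 2 ≤ v.im * ‖K‖ ∧ ‖u - v‖ ≤ 6 / 59 * v.im ∧
      112 / 59 * v.im ≤ ‖u - conj v‖ ∧ 47 / 118 * v.im ≤ ‖u - p‖ ∧ 112 / 59 * v.im ≤ ‖u - conj p‖ := by
  have hI : ‖I / (2 * (v.im : ℂ))‖ = 1 / (2 * v.im) := by
    rw [norm_div, Complex.norm_I, norm_mul, Complex.norm_real, Real.norm_eq_abs, abs_of_pos hv, Complex.norm_two]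
  have hK : 59 / 2 ≤ v.im * ‖K‖ := by
    have h1 := norm_add_le K (I / (2 * (v.im : ℂ)))
    rw [hI] at h1
    have h2 : v.im * ‖K + I / (2 * (v.im : ℂ))‖ ≤ v.im * (‖K‖ + 1 / (2 * v.im)) := mul_le_mul_of_nonneg_left h1 hv.le
    have e : v.im * (‖K‖ + 1 / (2 * v.im)) = v.im * ‖K‖ + 1 / 2 := by field_simp
    linarith
  have hKpos : 0 < ‖K‖ := by
    rcases (norm_nonneg K).eq_or_lt with e | e
    · rw [← e, mul_zero] at hK; norm_num at hK
    · exact e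
  have hr : ‖u - v‖ ≤ 6 / 59 * v.im := by
    have h1 : ‖u - v‖ * ‖K‖ ≤ 3 := (le_div_iff₀ hKpos).1 hu
    have h2 : 59 / 2 * ‖u - v‖ ≤ v.im * ‖K‖ * ‖u - v‖ := mul_le_mul_of_nonneg_right hK (norm_nonneg _)
    have h3 : v.im * (‖u - v‖ * ‖K‖) ≤ v.im * 3 := mul_le_mul_of_nonneg_left h1 hv.le
    have e : v.im * ‖K‖ * ‖u - v‖ = v.im * (‖u - v‖ * ‖K‖) := by ring
    linarith
  have him : v.im - ‖u - v‖ ≤ u.im := by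
    have h1 := Complex.abs_im_le_norm (v - u)
    rw [Complex.sub_im, norm_sub_rev] at h1
    have := (abs_le.1 h1).2
    linarith
  refine ⟨hK, hr, ?_, ?_, ?_⟩
  · have h1 := Complex.abs_im_le_norm (u - conj v)
    rw [Complex.sub_im, Complex.conj_im] at h1
    have := (abs_le.1 h1).2
    linarith
  · have h1 := norm_sub_norm_le (v - p) (v - u)
    have e : (v - p) - (v - u) = u - p := by ring
    rw [e, norm_sub_rev v u] at h1
    linarith
  · have h1 := Complex.abs_im_le_norm (u - conj p)
    rw [Complex.sub_im, Complex.conj_im] at h1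
    have := (abs_le.1 h1).2
    linarith

/-- ★ §4 (K, PROVED, f-free) **PAIR TERMS ON THE COUNT DISC.**  `0 < Im v < Im p`, `Im v ≤ 2‖v − p‖`, floor `30 ≤ Im v·‖K + i/(2 Im v)‖`, `‖u − v‖ ≤ 3/‖K‖` ⇒
`Im v²·‖−(u−v̄)⁻² − (u−p)⁻² − (u−p̄)⁻²‖ ≤ 7` (7/25 + 127/20 + 7/25 ≤ 7). -/
theorem pairTerms_mass_le {v p u K : ℂ} (hv : 0 < v.im) (hvp : v.im < p.im) (hsep : v.im ≤ 2 * ‖v - p‖)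
    (hfl : 30 ≤ v.im * ‖K + I / (2 * (v.im : ℂ))‖) (hu : ‖u - v‖ ≤ 3 / ‖K‖) :
    v.im ^ 2 * ‖-((u - conj v) ^ 2)⁻¹ - ((u - p) ^ 2)⁻¹ - ((u - conj p) ^ 2)⁻¹‖ ≤ 7 := by
  obtain ⟨-, -, hb1, hb2, hb3⟩ := countDisc_geometry hv hvp hsep hfl hu
  have t1 := sq_mul_norm_inv_sq_le (C := 7 / 25) hv (by norm_num) hb1 (by norm_num)
  have t2 := sq_mul_norm_inv_sq_le (C := 127 / 20) hv (by norm_num) hb2 (by norm_num)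
  have t3 := sq_mul_norm_inv_sq_le (C := 7 / 25) hv (by norm_num) hb3 (by norm_num)
  have tri : ‖-((u - conj v) ^ 2)⁻¹ - ((u - p) ^ 2)⁻¹ - ((u - conj p) ^ 2)⁻¹‖ ≤
      ‖((u - conj v) ^ 2)⁻¹‖ + ‖((u - p) ^ 2)⁻¹‖ + ‖((u - conj p) ^ 2)⁻¹‖ := by
    refine (norm_sub_le _ _).trans ?_
    have h1 := norm_sub_le (-((u - conj v) ^ 2)⁻¹) (((u - p) ^ 2)⁻¹)
    rw [norm_neg] at h1
    linarith
  have h4 : v.im ^ 2 * ‖-((u - conj v) ^ 2)⁻¹ - ((u - p) ^ 2)⁻¹ - ((u - conj p) ^ 2)⁻¹‖ ≤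
      v.im ^ 2 * (‖((u - conj v) ^ 2)⁻¹‖ + ‖((u - p) ^ 2)⁻¹‖ + ‖((u - conj p) ^ 2)⁻¹‖) :=
    mul_le_mul_of_nonneg_left tri (by positivity)
  have e : v.im ^ 2 * (‖((u - conj v) ^ 2)⁻¹‖ + ‖((u - p) ^ 2)⁻¹‖ + ‖((u - conj p) ^ 2)⁻¹‖) =
      v.im ^ 2 * ‖((u - conj v) ^ 2)⁻¹‖ + v.im ^ 2 * ‖((u - p) ^ 2)⁻¹‖ + v.im ^ 2 * ‖((u - conj p) ^ 2)⁻¹‖ := by ring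
  linarith

/-- §4 (K) **FULL MASS ≤ 7 + COFACTOR MASS** on the count disc: with `L′ = (g′/g)′(u)` and `Im v²·‖L′‖ ≤ M`,
`Im v²·‖−(u−v̄)⁻² − (u−p)⁻² − (u−p̄)⁻² + L′‖ ≤ 7 + M` (the `LightWitness` mass of `dslope f⁽ʲ⁾ v`, pair part explicit). -/
theorem fullMass_le {v p u K L' : ℂ} {M : ℝ} (hv : 0 < v.im) (hvp : v.im < p.im) (hsep : v.im ≤ 2 * ‖v - p‖)
    (hfl : 30 ≤ v.im * ‖K + I / (2 * (v.im : ℂ))‖) (hu : ‖u - v‖ ≤ 3 / ‖K‖) (hL : v.im ^ 2 * ‖L'‖ ≤ M) :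
    v.im ^ 2 * ‖-((u - conj v) ^ 2)⁻¹ - ((u - p) ^ 2)⁻¹ - ((u - conj p) ^ 2)⁻¹ + L'‖ ≤ 7 + M := by
  have h1 := pairTerms_mass_le hv hvp hsep hfl hu
  have h2 := norm_add_le (-((u - conj v) ^ 2)⁻¹ - ((u - p) ^ 2)⁻¹ - ((u - conj p) ^ 2)⁻¹) L'
  have h3 : v.im ^ 2 * ‖-((u - conj v) ^ 2)⁻¹ - ((u - p) ^ 2)⁻¹ - ((u - conj p) ^ 2)⁻¹ + L'‖ ≤
      v.im ^ 2 * (‖-((u - conj v) ^ 2)⁻¹ - ((u - p) ^ 2)⁻¹ - ((u - conj p) ^ 2)⁻¹‖ + ‖L'‖) :=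
    mul_le_mul_of_nonneg_left h2 (by positivity)
  have e : v.im ^ 2 * (‖-((u - conj v) ^ 2)⁻¹ - ((u - p) ^ 2)⁻¹ - ((u - conj p) ^ 2)⁻¹‖ + ‖L'‖) =
      v.im ^ 2 * ‖-((u - conj v) ^ 2)⁻¹ - ((u - p) ^ 2)⁻¹ - ((u - conj p) ^ 2)⁻¹‖ + v.im ^ 2 * ‖L'‖ := by ring
  linarith

/-! ## §5 (K) O1b: the `LightWitness` of `dslope f⁽ʲ⁾ v` from a cofactor witness (`dslope F v = G` is the tree's `RhW08.NewtonDoor.dslope_eq_of_factor`, BY NAME) -/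

/-- ★ §5 (K, PROVED) **LOG-DERIVATIVE OF THE DEFLATED PRODUCT.**  `G = (·−a)(·−b)(·−c)·g` with `g` entire and nothing vanishing at `u` ⇒
`(G′/G)′(u) = −(u−a)⁻² − (u−b)⁻² − (u−c)⁻² + (g′/g)′(u)`. -/
theorem deriv_logDeriv_threeFactor {G g : ℂ → ℂ} (hg : Differentiable ℂ g) {a b c u : ℂ}
    (hG : ∀ s, G s = (s - a) * (s - b) * (s - c) * g s) (ha : u ≠ a) (hb : u ≠ b) (hc : u ≠ c) (hgu : g u ≠ 0) :
    deriv (fun t => deriv G t / G t) u = -((u - a) ^ 2)⁻¹ - ((u - b) ^ 2)⁻¹ - ((u - c) ^ 2)⁻¹ + deriv (fun t => deriv g t / g t) u := by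
  have hGf : G = fun s => (s - a) * (s - b) * (s - c) * g s := funext hG
  have hGd : Differentiable ℂ G := by
    rw [hGf]; intro s
    exact (((differentiableAt_id.sub_const a).mul (differentiableAt_id.sub_const b)).mul (differentiableAt_id.sub_const c)).mul (hg s)
  have hdg : Differentiable ℂ (deriv g) := fun x => (hg.analyticAt x).deriv.differentiableAt
  -- pointwise formula where nothing vanishes
  have key : ∀ t : ℂ, G t ≠ 0 → deriv G t / G t = (t - a)⁻¹ + (t - b)⁻¹ + (t - c)⁻¹ + deriv g t / g t := by
    intro t ht
    have e1 : (t - a) * ((t - b) * (t - c) * g t) = G t := by rw [hG t]; ring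
    have e2 : (t - b) * ((t - a) * (t - c) * g t) = G t := by rw [hG t]; ring
    have e3 : (t - c) * ((t - a) * (t - b) * g t) = G t := by rw [hG t]; ring
    have e4 : g t * ((t - a) * (t - b) * (t - c)) = G t := by rw [hG t]; ring
    have h1 : t - a ≠ 0 := left_ne_zero_of_mul (e1 ▸ ht)
    have h2 : t - b ≠ 0 := left_ne_zero_of_mul (e2 ▸ ht)
    have h3 : t - c ≠ 0 := left_ne_zero_of_mul (e3 ▸ ht)
    have h4 : g t ≠ 0 := left_ne_zero_of_mul (e4 ▸ ht)
    have hd : HasDerivAt (fun s => (s - a) * (s - b) * (s - c) * g s)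
        (((1 * (t - b) + (t - a) * 1) * (t - c) + (t - a) * (t - b) * 1) * g t + (t - a) * (t - b) * (t - c) * deriv g t) t :=
      ((((hasDerivAt_id t).sub_const a).mul ((hasDerivAt_id t).sub_const b)).mul ((hasDerivAt_id t).sub_const c)).mul (hg t).hasDerivAt
    rw [hGf, hd.deriv]
    field_simp
  have hGu : G u ≠ 0 := by
    rw [hG u]; exact mul_ne_zero (mul_ne_zero (mul_ne_zero (sub_ne_zero.2 ha) (sub_ne_zero.2 hb)) (sub_ne_zero.2 hc)) hgu
  have hev : ∀ᶠ t in 𝓝 u, G t ≠ 0 := (hGd.continuous.continuousAt (x := u)).eventually_ne hGu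
  have heq : (fun t => deriv G t / G t) =ᶠ[𝓝 u] (fun t => (t - a)⁻¹ + (t - b)⁻¹ + (t - c)⁻¹ + deriv g t / g t) := by
    filter_upwards [hev] with t ht
    exact key t ht
  rw [heq.deriv_eq]
  -- derivative of an inverse linear factor (kept local: a top-level copy would restate tree lemmas)
  have hinv : ∀ {x : ℂ}, u ≠ x → HasDerivAt (fun t : ℂ => (t - x)⁻¹) (-((u - x) ^ 2)⁻¹) u := fun {x} hx => by
    have h := (hasDerivAt_inv (sub_ne_zero.2 hx)).comp u ((hasDerivAt_id u).sub_const x)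
    rw [mul_one] at h
    exact h
  have hsum : HasDerivAt (fun t => (t - a)⁻¹ + (t - b)⁻¹ + (t - c)⁻¹ + deriv g t / g t)
      (-((u - a) ^ 2)⁻¹ + -((u - b) ^ 2)⁻¹ + -((u - c) ^ 2)⁻¹ + deriv (fun t => deriv g t / g t) u) u :=
    (((hinv ha).add (hinv hb)).add (hinv hc)).add ((hdg u).div (hg u) hgu).hasDerivAt
  rw [hsum.deriv]; ring

/-- ★ §5 (K, PROVED) **LIGHT WITNESS FROM COFACTOR WITNESS (O1b).**  On a separated pair `(v, p)` (`0 < Im v < Im p`, `Im v ≤ 2‖v − p‖`) with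
`F = (·−v)(·−v̄)(·−p)(·−p̄)·g`, `g` entire, the floor `30 ≤ Im v·‖K_v + i/(2 Im v)‖` for `K_v = fieldK (dslope F v) v` and a cofactor witness `M` at `v`
on the count disc of `K_v`: the tree's `LightWitness (dslope F v) v (7 + M)` holds — so K-2's count/door machinery (#1190 ff.) runs UNCHANGED with
`M_full = 7 + M`.  With `F = iteratedDeriv j f` this is the v-side input of O1 under architecture (c). -/
theorem lightWitness_of_cofactorWitness {F g : ℂ → ℂ} {v p : ℂ} {M : ℝ} (hg : Differentiable ℂ g) (hv : 0 < v.im) (hvp : v.im < p.im)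
    (hsep : v.im ≤ 2 * ‖v - p‖) (hF : ∀ u : ℂ, F u = (u - v) * (u - conj v) * (u - p) * (u - conj p) * g u)
    (hfl : 30 ≤ v.im * ‖RhW08.PerturbativeRung.fieldK (dslope F v) v + I / (2 * (v.im : ℂ))‖)
    (hW : CofactorWitness g v (RhW08.PerturbativeRung.fieldK (dslope F v) v) M) :
    RhW08.PerturbativeRung.LightWitness (dslope F v) v (7 + M) := by
  have hGeq : dslope F v = fun u => (u - conj v) * (u - p) * (u - conj p) * g u :=
    RhW08.NewtonDoor.dslope_eq_of_factor (h := fun u => (u - conj v) * (u - p) * (u - conj p) * g u) (fun z => by rw [hF z]; ring)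
      ((((differentiableAt_id.sub_const _).mul (differentiableAt_id.sub_const _)).mul (differentiableAt_id.sub_const _)).mul (hg v))
  have hG : ∀ s, dslope F v s = (s - conj v) * (s - p) * (s - conj p) * g s := fun s => congrFun hGeq s
  have hK0 : 59 / 2 ≤ v.im * ‖RhW08.PerturbativeRung.fieldK (dslope F v) v‖ :=
    (countDisc_geometry (u := v) hv hvp hsep hfl (by rw [sub_self, norm_zero]; positivity)).1
  refine ⟨?_, by linarith [hW.1], fun u hu => ?_⟩
  · intro h0
    rw [h0, norm_zero, mul_zero] at hK0
    norm_num at hK0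
  · obtain ⟨-, -, hb1, hb2, hb3⟩ := countDisc_geometry hv hvp hsep hfl hu
    have h1 : u ≠ conj v := fun h => by rw [h, sub_self, norm_zero] at hb1; linarith
    have h2 : u ≠ p := fun h => by rw [h, sub_self, norm_zero] at hb2; linarith
    have h3 : u ≠ conj p := fun h => by rw [h, sub_self, norm_zero] at hb3; linarith
    have hgu : g u ≠ 0 := (hW.2 u hu).1
    refine ⟨?_, ?_⟩
    · rw [hG u]
      exact mul_ne_zero (mul_ne_zero (mul_ne_zero (sub_ne_zero.2 h1) (sub_ne_zero.2 h2)) (sub_ne_zero.2 h3)) hgu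
    · rw [deriv_logDeriv_threeFactor hg hG h1 h2 h3 hgu]
      exact fullMass_le hv hvp hsep hfl hu (hW.2 u hu).2

/-! ## §6 (K) PARAMETRIC (z-side capable) versions: floor replaced by `lam ≤ Im w·‖K‖`, separation by `d0·Im w ≤ ‖w − o‖` -/

/-- §6 (K, f-free) **PARAMETRIC COUNT-DISC GEOMETRY** (serves the z-side, where no floor is available and `λ` comes from coherence): `0 < Im w`, `0 < Im o`,
`0 < lam ≤ Im w·‖K‖`, `d0·Im w ≤ ‖w − o‖`, `‖u − w‖ ≤ 3/‖K‖` ⇒ radius `‖u − w‖ ≤ (3/lam)·Im w` and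
`‖u − w̄‖ ≥ (2 − 3/lam)·Im w`, `‖u − o‖ ≥ (d0 − 3/lam)·Im w`, `‖u − ō‖ ≥ (1 − 3/lam)·Im w`. -/
theorem countDisc_geometry_param {w o u K : ℂ} {lam d0 : ℝ} (hw : 0 < w.im) (ho : 0 < o.im) (hlam : 0 < lam) (hfl : lam ≤ w.im * ‖K‖)
    (hd : d0 * w.im ≤ ‖w - o‖) (hu : ‖u - w‖ ≤ 3 / ‖K‖) :
    ‖u - w‖ ≤ 3 / lam * w.im ∧ (2 - 3 / lam) * w.im ≤ ‖u - conj w‖ ∧ (d0 - 3 / lam) * w.im ≤ ‖u - o‖ ∧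
      (1 - 3 / lam) * w.im ≤ ‖u - conj o‖ := by
  have hKpos : 0 < ‖K‖ := by
    rcases (norm_nonneg K).eq_or_lt with e | e
    · rw [← e, mul_zero] at hfl; linarith
    · exact e
  have hr : ‖u - w‖ ≤ 3 / lam * w.im := by
    have h1 : ‖u - w‖ * ‖K‖ ≤ 3 := (le_div_iff₀ hKpos).1 hu
    have h2 : lam * ‖u - w‖ ≤ w.im * ‖K‖ * ‖u - w‖ := mul_le_mul_of_nonneg_right hfl (norm_nonneg _)
    have h3 : w.im * (‖u - w‖ * ‖K‖) ≤ w.im * 3 := mul_le_mul_of_nonneg_left h1 hw.le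
    have e : w.im * ‖K‖ * ‖u - w‖ = w.im * (‖u - w‖ * ‖K‖) := by ring
    have h4 : lam * ‖u - w‖ ≤ 3 * w.im := by linarith
    rw [div_mul_eq_mul_div, le_div_iff₀ hlam]
    linarith
  have e3 : 3 / lam * w.im = (3 / lam) * w.im := rfl
  have him : w.im - ‖u - w‖ ≤ u.im := by
    have h1 := Complex.abs_im_le_norm (w - u)
    rw [Complex.sub_im, norm_sub_rev] at h1
    have := (abs_le.1 h1).2
    linarith
  have hr' : ‖u - w‖ ≤ 3 / lam * w.im := hr
  have ex : (2 - 3 / lam) * w.im = 2 * w.im - 3 / lam * w.im := by ring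
  have ey : (d0 - 3 / lam) * w.im = d0 * w.im - 3 / lam * w.im := by ring
  have ez : (1 - 3 / lam) * w.im = w.im - 3 / lam * w.im := by ring
  refine ⟨hr, ?_, ?_, ?_⟩
  · have h1 := Complex.abs_im_le_norm (u - conj w)
    rw [Complex.sub_im, Complex.conj_im] at h1
    have := (abs_le.1 h1).2
    rw [ex]; linarith
  · have h1 := norm_sub_norm_le (w - o) (w - u)
    have e : (w - o) - (w - u) = u - o := by ring
    rw [e, norm_sub_rev w u] at h1
    rw [ey]; linarith
  · have h1 := Complex.abs_im_le_norm (u - conj o)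
    rw [Complex.sub_im, Complex.conj_im] at h1
    have := (abs_le.1 h1).2
    rw [ez]; linarith

/-- ★ §6 (K, PROVED, f-free) **PARAMETRIC PAIR TERMS ON A COUNT DISC.**  With `3/lam < 1` and `3/lam < d0` in addition:
`Im w²·‖−(u−w̄)⁻² − (u−o)⁻² − (u−ō)⁻²‖ ≤ ((2 − 3/lam)²)⁻¹ + ((d0 − 3/lam)²)⁻¹ + ((1 − 3/lam)²)⁻¹`
(v-side: lam = 59/2, d0 = 1/2 gives ≤ 7.82; z-side with C2's lam0 = 47/2 and d0 = 1/3: ≤ 25.3). -/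
theorem pairTerms_mass_le_param {w o u K : ℂ} {lam d0 : ℝ} (hw : 0 < w.im) (ho : 0 < o.im) (hlam : 0 < lam) (hl1 : 3 / lam < 1) (hld : 3 / lam < d0)
    (hfl : lam ≤ w.im * ‖K‖) (hd : d0 * w.im ≤ ‖w - o‖) (hu : ‖u - w‖ ≤ 3 / ‖K‖) :
    w.im ^ 2 * ‖-((u - conj w) ^ 2)⁻¹ - ((u - o) ^ 2)⁻¹ - ((u - conj o) ^ 2)⁻¹‖ ≤
      ((2 - 3 / lam) ^ 2)⁻¹ + ((d0 - 3 / lam) ^ 2)⁻¹ + ((1 - 3 / lam) ^ 2)⁻¹ := by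
  obtain ⟨-, hb1, hb2, hb3⟩ := countDisc_geometry_param hw ho hlam hfl hd hu
  have c1 : 0 < 2 - 3 / lam := by linarith
  have c2 : 0 < d0 - 3 / lam := by linarith
  have c3 : 0 < 1 - 3 / lam := by linarith
  have t1 := sq_mul_norm_inv_sq_le (C := ((2 - 3 / lam) ^ 2)⁻¹) hw c1 hb1 (by rw [inv_mul_cancel₀ (pow_ne_zero 2 c1.ne')])
  have t2 := sq_mul_norm_inv_sq_le (C := ((d0 - 3 / lam) ^ 2)⁻¹) hw c2 hb2 (by rw [inv_mul_cancel₀ (pow_ne_zero 2 c2.ne')])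
  have t3 := sq_mul_norm_inv_sq_le (C := ((1 - 3 / lam) ^ 2)⁻¹) hw c3 hb3 (by rw [inv_mul_cancel₀ (pow_ne_zero 2 c3.ne')])
  have tri : ‖-((u - conj w) ^ 2)⁻¹ - ((u - o) ^ 2)⁻¹ - ((u - conj o) ^ 2)⁻¹‖ ≤
      ‖((u - conj w) ^ 2)⁻¹‖ + ‖((u - o) ^ 2)⁻¹‖ + ‖((u - conj o) ^ 2)⁻¹‖ := by
    refine (norm_sub_le _ _).trans ?_
    have h1 := norm_sub_le (-((u - conj w) ^ 2)⁻¹) (((u - o) ^ 2)⁻¹)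
    rw [norm_neg] at h1
    linarith
  have h4 : w.im ^ 2 * ‖-((u - conj w) ^ 2)⁻¹ - ((u - o) ^ 2)⁻¹ - ((u - conj o) ^ 2)⁻¹‖ ≤
      w.im ^ 2 * (‖((u - conj w) ^ 2)⁻¹‖ + ‖((u - o) ^ 2)⁻¹‖ + ‖((u - conj o) ^ 2)⁻¹‖) :=
    mul_le_mul_of_nonneg_left tri (by positivity)
  have e : w.im ^ 2 * (‖((u - conj w) ^ 2)⁻¹‖ + ‖((u - o) ^ 2)⁻¹‖ + ‖((u - conj o) ^ 2)⁻¹‖) =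
      w.im ^ 2 * ‖((u - conj w) ^ 2)⁻¹‖ + w.im ^ 2 * ‖((u - o) ^ 2)⁻¹‖ + w.im ^ 2 * ‖((u - conj o) ^ 2)⁻¹‖ := by ring
  linarith

/-- ★ §6 (K, PROVED) **LIGHT WITNESS FROM COFACTOR WITNESS, PARAMETRIC (z-side capable).**  As `lightWitness_of_cofactorWitness` but with the floor replaced
by `0 < lam ≤ Im w·‖K_w‖` (`3/lam < 1`, `3/lam < d0`) and the separation by `d0·Im w ≤ ‖w − o‖`; mass constant
`((2 − 3/lam)²)⁻¹ + ((d0 − 3/lam)²)⁻¹ + ((1 − 3/lam)²)⁻¹ + M`.  For the TOUCHER `w = z`, `o = v` (no floor at `z`; `lam` from coherence, e.g. C2's 47/2). -/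
theorem lightWitness_of_cofactorWitness_param {F g : ℂ → ℂ} {w o : ℂ} {M lam d0 : ℝ} (hg : Differentiable ℂ g) (hw : 0 < w.im) (ho : 0 < o.im)
    (hlam : 0 < lam) (hl1 : 3 / lam < 1) (hld : 3 / lam < d0)
    (hF : ∀ u : ℂ, F u = (u - w) * (u - conj w) * (u - o) * (u - conj o) * g u)
    (hfl : lam ≤ w.im * ‖RhW08.PerturbativeRung.fieldK (dslope F w) w‖) (hd : d0 * w.im ≤ ‖w - o‖)
    (hW : CofactorWitness g w (RhW08.PerturbativeRung.fieldK (dslope F w) w) M) :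
    RhW08.PerturbativeRung.LightWitness (dslope F w) w
      (((2 - 3 / lam) ^ 2)⁻¹ + ((d0 - 3 / lam) ^ 2)⁻¹ + ((1 - 3 / lam) ^ 2)⁻¹ + M) := by
  have hGeq : dslope F w = fun u => (u - conj w) * (u - o) * (u - conj o) * g u :=
    RhW08.NewtonDoor.dslope_eq_of_factor (h := fun u => (u - conj w) * (u - o) * (u - conj o) * g u) (fun z => by rw [hF z]; ring)
      ((((differentiableAt_id.sub_const _).mul (differentiableAt_id.sub_const _)).mul (differentiableAt_id.sub_const _)).mul (hg w))
  have hG : ∀ s, dslope F w s = (s - conj w) * (s - o) * (s - conj o) * g s := fun s => congrFun hGeq s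
  have c1 : 0 < 2 - 3 / lam := by linarith
  have c2 : 0 < d0 - 3 / lam := by linarith
  have c3 : 0 < 1 - 3 / lam := by linarith
  refine ⟨?_, by have := hW.1; positivity, fun u hu => ?_⟩
  · intro h0
    rw [h0, norm_zero, mul_zero] at hfl
    linarith
  · obtain ⟨-, hb1, hb2, hb3⟩ := countDisc_geometry_param hw ho hlam hfl hd hu
    have p1 : 0 < (2 - 3 / lam) * w.im := by positivity
    have p2 : 0 < (d0 - 3 / lam) * w.im := by positivity
    have p3 : 0 < (1 - 3 / lam) * w.im := by positivity
    have h1 : u ≠ conj w := fun h => by rw [h, sub_self, norm_zero] at hb1; linarith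
    have h2 : u ≠ o := fun h => by rw [h, sub_self, norm_zero] at hb2; linarith
    have h3 : u ≠ conj o := fun h => by rw [h, sub_self, norm_zero] at hb3; linarith
    have hgu : g u ≠ 0 := (hW.2 u hu).1
    refine ⟨?_, ?_⟩
    · rw [hG u]
      exact mul_ne_zero (mul_ne_zero (mul_ne_zero (sub_ne_zero.2 h1) (sub_ne_zero.2 h2)) (sub_ne_zero.2 h3)) hgu
    · rw [deriv_logDeriv_threeFactor hg hG h1 h2 h3 hgu]
      have q1 := pairTerms_mass_le_param hw ho hlam hl1 hld hfl hd hu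
      have q2 := norm_add_le (-((u - conj w) ^ 2)⁻¹ - ((u - o) ^ 2)⁻¹ - ((u - conj o) ^ 2)⁻¹) (deriv (fun t => deriv g t / g t) u)
      have q3 : w.im ^ 2 * ‖-((u - conj w) ^ 2)⁻¹ - ((u - o) ^ 2)⁻¹ - ((u - conj o) ^ 2)⁻¹ + deriv (fun t => deriv g t / g t) u‖ ≤
          w.im ^ 2 * (‖-((u - conj w) ^ 2)⁻¹ - ((u - o) ^ 2)⁻¹ - ((u - conj o) ^ 2)⁻¹‖ + ‖deriv (fun t => deriv g t / g t) u‖) :=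
        mul_le_mul_of_nonneg_left q2 (by positivity)
      have e : w.im ^ 2 * (‖-((u - conj w) ^ 2)⁻¹ - ((u - o) ^ 2)⁻¹ - ((u - conj o) ^ 2)⁻¹‖ + ‖deriv (fun t => deriv g t / g t) u‖) =
          w.im ^ 2 * ‖-((u - conj w) ^ 2)⁻¹ - ((u - o) ^ 2)⁻¹ - ((u - conj o) ^ 2)⁻¹‖
            + w.im ^ 2 * ‖deriv (fun t => deriv g t / g t) u‖ := by ring
      linarith [(hW.2 u hu).2]

/-! ## §7 (K) the located child BY NAME: L1 (tree `RhW08.PairExactLocation.pairExactLocationQ_18`, token 89) ∘ O2 (§2) -/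
/-- ★ §7 (K, PROVED) **LOCATED CHILD** (= C2 g54 ADD-1's compose theorem, by name over the tree).  `g` entire, cofactor witness `M ≤ 10` at `w` on the count disc of
`K = (w−w̄)⁻¹ + (w−p)⁻¹ + (w−p̄)⁻¹ + (g′/g)(w)`, `Q = −((w−w̄)⁻² + (w−p)⁻² + (w−p̄)⁻²)`, floor `18 ≤ min (Im w) (Im p)·‖K‖`, separation `min (Im w) (Im p) ≤ 2‖w − p‖`: a point `u ≠ w`,
`‖u − w‖ ≤ 3/‖K‖`, satisfying the exact child equation (§3: e.g. a critical point of `F` there with no factor vanishing) lies within `((9/5)M + 2ρ)/(Im w‖K‖)²/‖K‖` of `w − K⁻¹ − QK⁻³`. -/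
theorem located_child {g : ℂ → ℂ} (hg : Differentiable ℂ g) {u w p K Q : ℂ} {M : ℝ} (hw : 0 < w.im) (hp : 0 < p.im)
    (hsep : min w.im p.im ≤ 2 * ‖w - p‖) (hK : K = (w - conj w)⁻¹ + (w - p)⁻¹ + (w - conj p)⁻¹ + deriv g w / g w)
    (hQ : Q = -((w - conj w)⁻¹ ^ 2 + (w - p)⁻¹ ^ 2 + (w - conj p)⁻¹ ^ 2)) (hfl : 18 ≤ min w.im p.im * ‖K‖)
    (hW : CofactorWitness g w K M) (hM10 : M ≤ 10) (hu : u ≠ w) (hdisc : ‖u - w‖ ≤ 3 / ‖K‖)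
    (hchild : (u - w)⁻¹ + (u - conj w)⁻¹ + (u - p)⁻¹ + (u - conj p)⁻¹ + deriv g u / g u = 0) :
    ‖u - (w - K⁻¹ - Q * K⁻¹ ^ 3)‖ ≤
      (9 / 5 * M + 2 * ((1 + (w.im / ‖w - p‖) ^ 3) / (w.im * ‖K‖))) / (w.im * ‖K‖) ^ 2 / ‖K‖ :=
  RhW08.PairExactLocation.pairExactLocationQ_18 u w p (deriv g w / g w) K Q M hw hp hsep hK hQ hfl hW.1 hM10 hu hdisc
    (location_of_childEq hg hw hW hdisc hchild)

end RhW08.PairExactFSide
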